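import Literature.Barriers.CriticalPhenomena.RigorousRGSmallParameterGaussianIntegration
import Mathlib.Probability.Distributions.Gaussian.HasGaussianLaw.Independence
import HarnessLib

/-!
# `RigorousRGSmallParameter` (Slade, Theorem 1.4.1): the factorisation property of the Gaussian
# expectation — `E_C(F₁(X) F₂(Y)) = (E_C F₁(X))(E_C F₂(Y))` when `C` vanishes between `X` and `Y`

Companion ("proof architecture") file of
`Literature/Barriers/CriticalPhenomena/RigorousRGSmallParameter.lean`. In the renormalisation
group step behind Slade's Theorem 6.3.1 (iterated in the named fact `Slade2017_prop822`), the
finite range of the fluctuation covariance `C_{j+1}` is used through "an independence consequence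
of the finite-range property, called the factorisation property of the expectation: if
`X_1,…,X_n ∈ 𝒫_{j+1}(Λ)` do not touch each other, and if `F_m(X_m) ∈ 𝒩(X_m)` for each `m`, then
`𝔼_{j+1}θ ∏ F_m(X_m) = ∏ 𝔼_{j+1}θ F_m(X_m)`. This factorisation property is a consequence of
[BS-rg-norm]" ([BS-rg-step] §1.3), namely of [BS-rg-norm] §2.11, Proposition (factorisation
property of the expectation): "Let `X, Y ⊂ Λ`, let `F_1(X) ∈ 𝒩(Λ ⊔ X')`, `F_2(Y) ∈ 𝒩(Λ ⊔ Y')`, and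
suppose that `C_{x',y'} = 0` whenever `x' ∈ X'`, `y' ∈ Y'`. Then
`E_C(F_1(X)F_2(Y)) = (E_C F_1(X))(E_C F_2(Y))`", whose bosonic part is proved there by "It is a
standard fact that uncorrelated Gaussian random vectors are independent [Eato07]".

This file PROVES the bosonic statement for the field Gaussian `P_C` of
`RigorousRGSmallParameterGaussianIntegration.lean` (`n`-component field on a finite set `Λ`,
`C` positive semidefinite), from Mathlib's "jointly Gaussian and uncorrelated ⇒ independent"
(`HasGaussianLaw.indepFun_of_covariance_eval`):

* `isGaussian_fieldGaussian` (`P_C` is a Gaussian measure), `covariance_eval_fieldGaussian`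
  (`cov(ζ_xⁱ, ζ_yʲ) = δ_{ij} C_{xy}`), **`indepFun_restrict_fieldGaussian`** (`ζ|_{D₁} ⟂ ζ|_{D₂}`
  when `C = 0` on `D₁ × D₂`);
* **`integral_mul_eq_mul_integral_of_dependsOn`**: `E_C(FG) = (E_C F)(E_C G)` for measurable
  `F ∈ 𝒩(D₁)`, `G ∈ 𝒩(D₂)` with `C_{xy} = 0` for `x ∈ D₁`, `y ∈ D₂`;
* **`thetaConv_mul_of_dependsOn`**: the same for `E_C θ` (`θF(φ,ζ) = F(φ+ζ)`), i.e. the form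
  (Efaczz) takes for two factors once `dist(D₁, D₂)` exceeds the range of `C`.

The geometric input (non-touching `(j+1)`-polymers have small-set neighbourhoods farther apart
than the range `½L^{j+1}` of `C_{j+1}`, Slade (3.3)) is not treated here.

## References

* [BrydgesSlade2015RGI] D. C. Brydges, G. Slade, *A renormalisation group method. I. Gaussian
  integration and normed algebras*, J. Stat. Phys. **159** (2015) 421–460, arXiv:1403.7244 —
  §2.11, Proposition (factorisation property).
* [BrydgesSlade2015RGV] D. C. Brydges, G. Slade, *A renormalisation group method. V. A single
  renormalisation group step*, J. Stat. Phys. **159** (2015) 589–667, arXiv:1403.7256 — §1.3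
  (display (Efaczz)), §5.1.
* [Slade2017] G. Slade, *Critical exponents for long-range O(n) models below the upper critical
  dimension*, Commun. Math. Phys. **358** (2018) 343–436, arXiv:1611.06169 — §4.1 (`P_C`, `E_Cθ`).
-/

noncomputable section

namespace Literature.Barriers.CriticalPhenomena

open _root_.MeasureTheory _root_.ProbabilityTheory Finset Matrix
open scoped ENNReal

namespace LongRangePhi4

section Factorisation

variable {Λ : Type*} [Fintype Λ] [DecidableEq Λ] {n : ℕ}

/-- Field space as a continuous linear image of Euclidean `ℝ^{Λ×n}` (the map underlying
`fieldEquiv`). [folklore] -/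
def fieldCLM (Λ : Type*) [Fintype Λ] (n : ℕ) : EuclideanSpace ℝ (Λ × Fin n) →L[ℝ] (Λ → Fin n → ℝ) :=
  LinearMap.toContinuousLinearMap
    { toFun := fun y x i => y (x, i)
      map_add' := fun _ _ => rfl
      map_smul' := fun _ _ => rfl }

omit [DecidableEq Λ] in
/-- `fieldCLM` is `fieldEquiv` as a function. [folklore] -/
theorem coe_fieldCLM : ⇑(fieldCLM Λ n) = ⇑(fieldEquiv Λ n) := rfl

/-- **`P_C` is a Gaussian measure** (a continuous linear image of `N(0, C ⊗ 1ₙ)`). [folklore] -/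
instance isGaussian_fieldGaussian (C : Matrix Λ Λ ℝ) : IsGaussian (fieldGaussian Λ C n) := by
  rw [fieldGaussian, ← coe_fieldCLM]
  infer_instance

/-- Coordinates have a Gaussian law under `P_C` (jointly, for any two families of sites). [folklore] -/
theorem hasGaussianLaw_restrict_pair (C : Matrix Λ Λ ℝ) (D₁ D₂ : Finset Λ) :
    HasGaussianLaw (fun ζ : Λ → Fin n → ℝ =>
      ((fun p : ↥D₁ × Fin n => ζ p.1.1 p.2), (fun q : ↥D₂ × Fin n => ζ q.1.1 q.2))) (fieldGaussian Λ C n) := by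
  let L : (Λ → Fin n → ℝ) →L[ℝ] ((↥D₁ × Fin n → ℝ) × (↥D₂ × Fin n → ℝ)) :=
    LinearMap.toContinuousLinearMap
      { toFun := fun ζ => ((fun p : ↥D₁ × Fin n => ζ p.1.1 p.2), (fun q : ↥D₂ × Fin n => ζ q.1.1 q.2))
        map_add' := fun _ _ => rfl
        map_smul' := fun _ _ => rfl }
  have : (fun ζ : Λ → Fin n → ℝ =>
      ((fun p : ↥D₁ × Fin n => ζ p.1.1 p.2), (fun q : ↥D₂ × Fin n => ζ q.1.1 q.2))) = ⇑L := rfl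
  rw [this]
  exact ⟨inferInstance⟩

/-- A single coordinate has a Gaussian law under `P_C`. [folklore] -/
theorem hasGaussianLaw_eval (C : Matrix Λ Λ ℝ) (x : Λ) (i : Fin n) :
    HasGaussianLaw (fun ζ : Λ → Fin n → ℝ => ζ x i) (fieldGaussian Λ C n) := by
  let L : (Λ → Fin n → ℝ) →L[ℝ] ℝ :=
    LinearMap.toContinuousLinearMap
      { toFun := fun ζ => ζ x i
        map_add' := fun _ _ => rfl
        map_smul' := fun _ _ => rfl }
  have : (fun ζ : Λ → Fin n → ℝ => ζ x i) = ⇑L := rfl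
  rw [this]
  exact ⟨inferInstance⟩

/-- **Covariance of coordinates under `P_C`**: `cov(ζ_xⁱ, ζ_yʲ) = δ_{ij} C_{xy}`. [cite: Slade2017, §4.1 (Gaussian measure P_C with covariance C)] -/
theorem covariance_eval_fieldGaussian {C : Matrix Λ Λ ℝ} (hC : C.PosSemidef) (x y : Λ) (i j : Fin n) :
    cov[fun ζ : Λ → Fin n → ℝ => ζ x i, fun ζ => ζ y j; fieldGaussian Λ C n] = if i = j then C x y else 0 := by
  rw [covariance_eq_sub (hasGaussianLaw_eval C x i).memLp_two (hasGaussianLaw_eval C y j).memLp_two]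
  simp only [Pi.mul_apply]
  rw [integral_eval_mul_eval_fieldGaussian hC]
  have h1 : ∫ ζ : Λ → Fin n → ℝ, ζ x i ∂(fieldGaussian Λ C n) = 0 := integral_eval_fieldGaussian C x i
  have h2 : ∫ ζ : Λ → Fin n → ℝ, ζ y j ∂(fieldGaussian Λ C n) = 0 := integral_eval_fieldGaussian C y j
  simp only [h1, h2, mul_zero, sub_zero]

/-- **Independence of the field on regions with vanishing cross-covariance**: if `C_{xy} = 0`
for `x ∈ D₁`, `y ∈ D₂`, then `ζ|_{D₁}` and `ζ|_{D₂}` are independent under `P_C` (jointly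
Gaussian and uncorrelated). [folklore] -/
theorem indepFun_restrict_fieldGaussian {C : Matrix Λ Λ ℝ} (hC : C.PosSemidef) {D₁ D₂ : Finset Λ}
    (h0 : ∀ x ∈ D₁, ∀ y ∈ D₂, C x y = 0) :
    IndepFun (fun (ζ : Λ → Fin n → ℝ) (p : ↥D₁ × Fin n) => ζ p.1.1 p.2)
      (fun (ζ : Λ → Fin n → ℝ) (q : ↥D₂ × Fin n) => ζ q.1.1 q.2) (fieldGaussian Λ C n) := by
  refine (hasGaussianLaw_restrict_pair C D₁ D₂).indepFun_of_covariance_eval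
    (X := fun (p : ↥D₁ × Fin n) (ζ : Λ → Fin n → ℝ) => ζ p.1.1 p.2)
    (Y := fun (q : ↥D₂ × Fin n) (ζ : Λ → Fin n → ℝ) => ζ q.1.1 q.2) fun p q => ?_
  rw [covariance_eval_fieldGaussian hC]
  split_ifs
  · exact h0 _ p.1.2 _ q.1.2
  · rfl

/-- Extension by zero of a field given on `D`. [folklore] -/
def extendField (D : Finset Λ) (u : ↥D × Fin n → ℝ) : Λ → Fin n → ℝ :=
  fun x k => if hx : x ∈ D then u (⟨x, hx⟩, k) else 0

omit [Fintype Λ] in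
/-- `extendField` is measurable. [folklore] -/
theorem measurable_extendField (D : Finset Λ) : Measurable (extendField (n := n) D) := by
  refine measurable_pi_lambda _ fun x => measurable_pi_lambda _ fun k => ?_
  by_cases hx : x ∈ D
  · simp only [extendField, hx, dite_true]
    exact measurable_pi_apply _
  · simp only [extendField, hx, dite_false]
    exact measurable_const

omit [Fintype Λ] in
/-- A function of the field that depends only on the sites in `D` factors through the
restriction to `D`. [folklore] -/
theorem eq_comp_restrict_of_dependsOn {D : Finset Λ} {F : (Λ → Fin n → ℝ) → ℝ}
    (hF : ∀ φ ψ : Λ → Fin n → ℝ, (∀ x ∈ D, φ x = ψ x) → F φ = F ψ) (ζ : Λ → Fin n → ℝ) :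
    F ζ = F (extendField D (fun p : ↥D × Fin n => ζ p.1.1 p.2)) := by
  refine hF _ _ fun x hx => ?_
  funext k
  simp [extendField, hx]

/-- **Factorisation property of the Gaussian expectation** ([BS-rg-step] (Efaczz), the finite
range property of `𝔼`): if `F ∈ 𝒩(D₁)`, `G ∈ 𝒩(D₂)` (measurable) and the covariance vanishes
between `D₁` and `D₂` (`C_{xy} = 0` for `x ∈ D₁, y ∈ D₂` — e.g. `dist(D₁,D₂)` exceeds the range
of `C`), then `E_C(FG) = (E_C F)(E_C G)`. [cite: BrydgesSlade2015RGI, §2.11, Proposition (factorisation property of the expectation), bosonic part] [cite: BrydgesSlade2015RGV, §1.3 (display (Efaczz))] -/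
theorem integral_mul_eq_mul_integral_of_dependsOn {C : Matrix Λ Λ ℝ} (hC : C.PosSemidef)
    {D₁ D₂ : Finset Λ} (h0 : ∀ x ∈ D₁, ∀ y ∈ D₂, C x y = 0) {F G : (Λ → Fin n → ℝ) → ℝ}
    (hF : ∀ φ ψ : Λ → Fin n → ℝ, (∀ x ∈ D₁, φ x = ψ x) → F φ = F ψ)
    (hG : ∀ φ ψ : Λ → Fin n → ℝ, (∀ x ∈ D₂, φ x = ψ x) → G φ = G ψ)
    (mF : Measurable F) (mG : Measurable G) :
    ∫ ζ, F ζ * G ζ ∂(fieldGaussian Λ C n) =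
      (∫ ζ, F ζ ∂(fieldGaussian Λ C n)) * ∫ ζ, G ζ ∂(fieldGaussian Λ C n) := by
  have hind := indepFun_restrict_fieldGaussian (n := n) hC h0
  set f : (↥D₁ × Fin n → ℝ) → ℝ := fun u => F (extendField D₁ u) with hf
  set g : (↥D₂ × Fin n → ℝ) → ℝ := fun u => G (extendField D₂ u) with hg
  have hFf : ∀ ζ, F ζ = f (fun p : ↥D₁ × Fin n => ζ p.1.1 p.2) := fun ζ => eq_comp_restrict_of_dependsOn hF ζ
  have hGg : ∀ ζ, G ζ = g (fun q : ↥D₂ × Fin n => ζ q.1.1 q.2) := fun ζ => eq_comp_restrict_of_dependsOn hG ζ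
  have mf : Measurable f := mF.comp (measurable_extendField D₁)
  have mg : Measurable g := mG.comp (measurable_extendField D₂)
  have mX : Measurable fun (ζ : Λ → Fin n → ℝ) (p : ↥D₁ × Fin n) => ζ p.1.1 p.2 :=
    measurable_pi_lambda _ fun p => (measurable_pi_apply p.2).comp (measurable_pi_apply p.1.1)
  have mY : Measurable fun (ζ : Λ → Fin n → ℝ) (q : ↥D₂ × Fin n) => ζ q.1.1 q.2 :=
    measurable_pi_lambda _ fun q => (measurable_pi_apply q.2).comp (measurable_pi_apply q.1.1)
  simp_rw [hFf, hGg]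
  exact hind.integral_fun_comp_mul_comp mX.aemeasurable mY.aemeasurable mf.aestronglyMeasurable
    mg.aestronglyMeasurable

/-- **Factorisation of `E_C θ`**: `E_Cθ(FG) = (E_CθF)(E_CθG)` for `F ∈ 𝒩(D₁)`, `G ∈ 𝒩(D₂)` with
vanishing covariance between `D₁` and `D₂` — the form in which the finite-range property of the
fluctuation covariance `C_{j+1}` is used in the renormalisation group step ("factorisation
property (Efaczz) of `𝔼₊`"). [cite: BrydgesSlade2015RGV, §5.1 (Proposition (prop:K3): "the finite-range property (Efaczz) of 𝔼₊")] -/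
theorem thetaConv_mul_of_dependsOn {C : Matrix Λ Λ ℝ} (hC : C.PosSemidef) {D₁ D₂ : Finset Λ}
    (h0 : ∀ x ∈ D₁, ∀ y ∈ D₂, C x y = 0) {F G : (Λ → Fin n → ℝ) → ℝ}
    (hF : ∀ φ ψ : Λ → Fin n → ℝ, (∀ x ∈ D₁, φ x = ψ x) → F φ = F ψ)
    (hG : ∀ φ ψ : Λ → Fin n → ℝ, (∀ x ∈ D₂, φ x = ψ x) → G φ = G ψ)
    (mF : Measurable F) (mG : Measurable G) (φ : Λ → Fin n → ℝ) :
    thetaConv (fieldGaussian Λ C n) (F * G) φ =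
      thetaConv (fieldGaussian Λ C n) F φ * thetaConv (fieldGaussian Λ C n) G φ := by
  simp only [thetaConv, Pi.mul_apply]
  refine integral_mul_eq_mul_integral_of_dependsOn hC h0 (fun ζ ζ' h => hF _ _ fun x hx => ?_)
    (fun ζ ζ' h => hG _ _ fun x hx => ?_) (mF.comp (measurable_const_add φ)) (mG.comp (measurable_const_add φ))
  · simp only [Pi.add_apply, h x hx]
  · simp only [Pi.add_apply, h x hx]

end Factorisation

end LongRangePhi4

end Literature.Barriers.CriticalPhenomena
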